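import Summits.CriticalPhenomena.Ising3DConformalLimit.Theorems.LinkingParityCirclesSpinRatioMoebiusEquivalences
import Summits.CriticalPhenomena.Ising3DConformalLimit.Theorems.HarmonicMomentsIsotropyTwoPointAsymptoticIsotropyOfPointwiseLimit
import Summits.CriticalPhenomena.Ising3DConformalLimit.Theorems.PrecisionLaplacianMoebiusLimitOfTwoPointLawRegularOfLimitExists
import Summits.CriticalPhenomena.Ising3DConformalLimit.Theses.WeylWindow
import HarnessLib

/-!
# Crux `LinkingParityCircles.SpinRatioMoebius` (stmt-CriticalPhenomena-4530): the EXISTENCE half and its avatars —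
# `∃ ratio limits ⇔ RatioLimit (4841) ⇔ LimitExists (4738) ⇔ ExistsRegularLimit (5355) ⇔ ExistsScaleCovariantLimit (1981)`

The existence half of the crux (locally uniform limits of the weight-free spin pairing ratios at every level) is
equivalent to the BARE existence of a non-degenerate pointwise scaling limit of the critical correlators on `ℤ³`
(item stmt-CriticalPhenomena-4738 `WeylWindow.LimitExists`): forward through the pinned limit
(`pinnedLimit_of_ratioLimits`), backward through `stub_ratioLimitOfScalingLimit`.  With the landed equivalences
`RatioLimit (4841) ⇔ ∃ ratio limits` (`ratioLimits_iff_CCIRatioLimit`), `ExistsRegularLimit (5355) ⇔ LimitExists (4738)`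
(`existsRegularLimit_iff_limitExists`) and `ExistsScaleCovariantLimit (1981) ⇔ bare existence`
(`existsScaleCovariantLimit_iff_pointwiseLimit`), the existence cruxes of the routes `CurrentConnectionInvariance`,
`WeylWindow`, `PrimaryAtInfinity` and `HyperoctahedralRP` are ONE item; and the crux of `LinkingParityCircles` is
`LimitExists ∧ RatioInversionInvariance (4840)`.

References: H. Duminil-Copin, Proc. ICM 2022 §8.4 (existence of the critical scaling limit on `ℤ³` is open).
-/

noncomputable section

namespace Summit.CriticalPhenomena.Ising3DConformalLimit.Cruxes.SpinRatioMoebius.Birth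

open Literature.Probability.LatticeModels Filter Set
open Summit.CriticalPhenomena.Ising3DConformalLimit.Theses
open scoped Topology

/-- Ratio limits at every level ⇒ item stmt-CriticalPhenomena-4738 `WeylWindow.LimitExists` (the pinned limit). [folklore] -/
theorem limitExists_of_ratioLimits
    (hL : ∃ q : CorrFamily 3, ∀ m : ℕ, TendstoLocallyUniformlyOn (fun (δ : ℝ) (x : Fin (m + m) → EuclideanSpace ℝ (Fin 3)) =>
      criticalCorr 3 (m + m) (fun i => latticeApprox δ (x i)) /
        ∏ j : Fin m, criticalCorr 3 2 ![latticeApprox δ (x (Fin.castAdd m j)), latticeApprox δ (x (Fin.natAdd m j))])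
      (q (m + m)) (𝓝[>] (0 : ℝ)) (NonCoincident 3 (m + m))) :
    WeylWindow.LimitExists := by
  obtain ⟨q, hq⟩ := hL
  obtain ⟨ρ, Δ, ψ, S, hρ, hS, -, hnd, -⟩ := pinnedLimit_of_ratioLimits hq
  exact ⟨ρ, S, hρ, hS, hnd⟩

/-- Item stmt-CriticalPhenomena-4738 `WeylWindow.LimitExists` ⇒ ratio limits at every level. [folklore] -/
theorem ratioLimits_of_limitExists (h : WeylWindow.LimitExists) :
    ∃ q : CorrFamily 3, ∀ m : ℕ, TendstoLocallyUniformlyOn (fun (δ : ℝ) (x : Fin (m + m) → EuclideanSpace ℝ (Fin 3)) =>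
      criticalCorr 3 (m + m) (fun i => latticeApprox δ (x i)) /
        ∏ j : Fin m, criticalCorr 3 2 ![latticeApprox δ (x (Fin.castAdd m j)), latticeApprox δ (x (Fin.natAdd m j))])
      (q (m + m)) (𝓝[>] (0 : ℝ)) (NonCoincident 3 (m + m)) := by
  obtain ⟨_, _, hρ, hlim, hnd⟩ := h
  exact ratioLimits_of_scalingLimit hρ hlim hnd

/-- **The existence half of the crux ⇔ bare existence of a non-degenerate scaling limit (item 4738).** [folklore] -/
theorem ratioLimits_iff_limitExists :
    (∃ q : CorrFamily 3, ∀ m : ℕ, TendstoLocallyUniformlyOn (fun (δ : ℝ) (x : Fin (m + m) → EuclideanSpace ℝ (Fin 3)) =>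
      criticalCorr 3 (m + m) (fun i => latticeApprox δ (x i)) /
        ∏ j : Fin m, criticalCorr 3 2 ![latticeApprox δ (x (Fin.castAdd m j)), latticeApprox δ (x (Fin.natAdd m j))])
      (q (m + m)) (𝓝[>] (0 : ℝ)) (NonCoincident 3 (m + m))) ↔ WeylWindow.LimitExists :=
  ⟨limitExists_of_ratioLimits, ratioLimits_of_limitExists⟩

/-- **Items stmt-CriticalPhenomena-4841 `RatioLimit` and stmt-CriticalPhenomena-4738 `LimitExists` are equivalent**:
the existence crux of route `CurrentConnectionInvariance` is bare existence of a non-degenerate scaling limit. [folklore] -/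
theorem CCIRatioLimit_iff_limitExists :
    Summit.CriticalPhenomena.Ising3DConformalLimit.Theses.CurrentConnectionInvariance.RatioLimit ↔ Summit.CriticalPhenomena.Ising3DConformalLimit.Theses.WeylWindow.LimitExists :=
  ratioLimits_iff_CCIRatioLimit.symm.trans ratioLimits_iff_limitExists

/-- Item 4841 `RatioLimit` ⇔ item stmt-CriticalPhenomena-5355 `PrimaryAtInfinity.ExistsRegularLimit`. [folklore] -/
theorem CCIRatioLimit_iff_existsRegularLimit :
    CurrentConnectionInvariance.RatioLimit ↔ PrimaryAtInfinity.ExistsRegularLimit :=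
  CCIRatioLimit_iff_limitExists.trans PrecisionLaplacianMoebiusLimitOfTwoPointLaw.existsRegularLimit_iff_limitExists.symm

/-- Item 4841 `RatioLimit` ⇔ item stmt-CriticalPhenomena-1981 `HyperoctahedralRP.ExistsScaleCovariantLimit`. [folklore] -/
theorem CCIRatioLimit_iff_existsScaleCovariantLimit :
    CurrentConnectionInvariance.RatioLimit ↔ HyperoctahedralRP.ExistsScaleCovariantLimit :=
  CCIRatioLimit_iff_limitExists.trans HarmonicMomentsIsotropyTwoPoint.existsScaleCovariantLimit_iff_pointwiseLimit.symm

/-- **The crux of `LinkingParityCircles` is bare existence plus the inversion crux of `CurrentConnectionInvariance`**: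
`SpinRatioMoebius ⇔ LimitExists (4738) ∧ RatioInversionInvariance (4840)`. [folklore] -/
theorem SpinRatioMoebius_iff_limitExists_and_CCIRatioInversion :
    LinkingParityCircles.SpinRatioMoebius ↔ WeylWindow.LimitExists ∧ CurrentConnectionInvariance.RatioInversionInvariance :=
  SpinRatioMoebius_iff_CCI_items.trans (and_congr_left fun _ => CCIRatioLimit_iff_limitExists)

/-- Likewise for item 1344: `MoebiusLimit ⇔ LimitExists (4738) ∧ RatioInversionInvariance (4840)` — the conformal content
of the conjunct minus (iii), beyond bare existence, is exactly the asymptotic inversion invariance of the telescoping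
ratios on the lattice. [folklore] -/
theorem moebiusLimit_iff_limitExists_and_CCIRatioInversion :
    EnergyNotSigmaSquared.MoebiusLimit ↔ WeylWindow.LimitExists ∧ CurrentConnectionInvariance.RatioInversionInvariance :=
  SpinRatioMoebius_iff_moebiusLimit.symm.trans SpinRatioMoebius_iff_limitExists_and_CCIRatioInversion

end Summit.CriticalPhenomena.Ising3DConformalLimit.Cruxes.SpinRatioMoebius.Birth

end
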